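import Summits.AtomisticToContinuum.HydrodynamicLimit.Theorems.MourreKoopmanChargesOneBodyCompletenessReduction
import Summits.AtomisticToContinuum.HydrodynamicLimit.Theorems.MourreKoopmanChargesOneBodyCompletenessGibbsOrthogonality
import HarnessLib

/-!
# `OneBodyCompleteness` (crux stmt-AtomisticToContinuum-9583, route `MourreKoopmanCharges`):
# the reduction with Maxwellian orthogonality discharged

Helper file (`--supports stmt-AtomisticToContinuum-9583`, line `registered`, skeleton v4 of
`Cruxes/OneBodyCompleteness/Lines/birth.lean`). The v3 reduction
`oneBodyCompleteness_of_framework` (file `…OneBodyCompletenessReduction.lean`) takes a unit-diameter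
fluctuation framework whose datum `F` satisfies, besides existence/packaging clauses, the MAXWELLIAN
ORTHOGONALITY `⟪[A_g], q_i⟫_{ℋ_F} = 0` for one-body cell observables `A_g` of profiles
`g ⊥ {1, v, |v|²}` in `L²(M_1)`. That clause is a theorem about every DLR hard-sphere Gibbs state:
by the landed `gibbsMaxwellianOrthogonality` (file `…OneBodyCompletenessGibbsOrthogonality.lean`:
given the positions, the velocities under the specification are i.i.d. Maxwellian, so
`cov[cellObs g, cellCharge i ∘ τ_x; μ] = 0` for every shift `x`) and Spohn's formula
`⟪[a], [b]⟫_ℋ = ∫ cov[a, b ∘ τ_x; μ] dx` (`inner_fluct_fluct`, `form_def`), it follows from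
`cellObs g ∈ 𝒱`. Hence the framework hypothesis can be weakened to its existence/packaging part:

  `oneBodyCompleteness_of_frameworkNoOrth : (framework, no orthogonality clause) → (identification) →
     ChargesCompleteHS → OneBodyCompleteness`.

References: H. Spohn, *Large Scale Dynamics of Interacting Particles* (1991), Part I §7.1 (7.6)–(7.7);
R. Alexander, Comm. Math. Phys. 49 (1976) §2.1–2.2 (Maxwellian momenta in the DLR specification).
-/

noncomputable section

namespace Summit.AtomisticToContinuum.HydrodynamicLimit.Theorems.MourreKoopmanChargesOneBodyCompleteness

open scoped BigOperators Topology InnerProductSpace ENNReal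
open Filter Set Function MeasureTheory ProbabilityTheory

/-- **Maxwellian orthogonality in `ℋ_F`** for a unit-diameter, unit-inverse-temperature Gibbs datum:
if `F.μ` is a DLR hard-sphere Gibbs state `IsHardSphereGibbs 1 z 1 0` and the one-body cell
observable `A_g` of a continuous polynomially bounded `g ⊥ {1, v, |v|²}` in `L²(M_1)` lies in `𝒱`,
then `⟪[A_g], q_i⟫_{ℋ_F} = 0` for the five charge classes (`⟪[a],[b]⟫ = ∫ cov[a, b ∘ τ_x] dx` and each
covariance vanishes by `gibbsMaxwellianOrthogonality`). [Spohn1991 Part I §7.1 (7.6)–(7.7)] -/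
theorem inner_fluct_cellObs_chargeClass_eq_zero {z : ℝ} (hz : 0 < z)
    (F : Literature.MathematicalPhysics.KineticTheory.HardSphereFluctuationData 1)
    (hG : Literature.Analysis.FluidPDE.IsHardSphereGibbs 1 z 1
      (0 : Literature.MathematicalPhysics.KineticTheory.V3) F.μ)
    {g : Literature.MathematicalPhysics.KineticTheory.V3 → ℝ} (hg : Continuous g)
    (hb : ∃ (C : ℝ) (k : ℕ), ∀ v, |g v| ≤ C * (1 + ‖v‖) ^ k)
    (hmem : Literature.MathematicalPhysics.KineticTheory.cellObs g ∈ F.localObs)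
    (hm0 : ∫ v, g v * Literature.Analysis.FluidPDE.localMaxwellian 1 1
      (0 : Literature.MathematicalPhysics.KineticTheory.V3) v = 0)
    (hm1 : ∀ i : Fin 3, ∫ v, g v * v i * Literature.Analysis.FluidPDE.localMaxwellian 1 1
      (0 : Literature.MathematicalPhysics.KineticTheory.V3) v = 0)
    (hm2 : ∫ v, g v * ‖v‖ ^ 2 * Literature.Analysis.FluidPDE.localMaxwellian 1 1
      (0 : Literature.MathematicalPhysics.KineticTheory.V3) v = 0) (i : Fin 5) :
    ⟪F.fluct (Literature.MathematicalPhysics.KineticTheory.cellObs g), F.chargeClass i⟫_ℝ = 0 := by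
  have hG' : Literature.Analysis.FluidPDE.IsHardSphereGibbs 1 z (1 : ℝ)⁻¹
      (0 : Literature.MathematicalPhysics.KineticTheory.V3) F.μ := by
    rw [inv_one]; exact hG
  rw [Literature.MathematicalPhysics.KineticTheory.HardSphereFluctuationData.chargeClass_def,
    Literature.MathematicalPhysics.KineticTheory.FluctuationStructure.inner_fluct_fluct hmem (F.cellCharge_mem i),
    Literature.MathematicalPhysics.KineticTheory.FluctuationStructure.form_def]
  simp only [gibbsMaxwellianOrthogonality 1 z 1 one_pos hz one_pos F.μ hG' g hg hb hm0 hm1 hm2 i,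
    integral_zero]

/-- **REDUCTION OF THE CRUX, v4** (kernel-checked, axiom-clean): the unit-diameter fluctuation
framework WITHOUT the orthogonality clause (= registered stub `stub_gibbsFluctuationDataNoOrth` of line
`registered`), the unit-diameter diagonal identification (= registered stub
`stub_torusIdentificationUnit`) and the route item `ChargesCompleteHS` (stmt-14141) imply the crux
`MourreKoopmanCharges.OneBodyCompleteness` BY NAME (upgrade the framework with
`inner_fluct_cellObs_chargeClass_eq_zero`, then `oneBodyCompleteness_of_framework`). [folklore] -/
theorem oneBodyCompleteness_of_frameworkNoOrth :
    (∀ z₀ : ℝ, 0 < z₀ → ∃ σ₁ : ℝ, 0 < σ₁ ∧ ∀ σ : ℝ, 0 < σ → σ < σ₁ →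
      ∃ (F : Literature.MathematicalPhysics.KineticTheory.HardSphereFluctuationData 1) (z : ℝ),
        0 < z ∧ z < z₀ ∧
        Literature.Analysis.FluidPDE.IsHardSphereGibbs 1 z 1
          (0 : Literature.MathematicalPhysics.KineticTheory.V3) F.μ ∧
        (∃ Φ : Literature.Analysis.FluidPDE.InfiniteHardSphereFlow (Fin 3) 1,
          Φ.IsEquilibriumFlow ∧ ∀ t : ℝ, F.flow t =ᵐ[F.μ] Φ.flow t) ∧
        (∫ ω, Literature.MathematicalPhysics.KineticTheory.cellCharge 0 ω ∂F.μ = σ ^ 3) ∧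
        (∀ ψ : Literature.MathematicalPhysics.KineticTheory.HardSphereFluctuationSpace F,
          Continuous fun t : ℝ => F.koopman t ψ) ∧
        (∀ g : Literature.MathematicalPhysics.KineticTheory.V3 → ℝ, Continuous g →
          (∃ (C : ℝ) (k : ℕ), ∀ v, |g v| ≤ C * (1 + ‖v‖) ^ k) →
          Literature.MathematicalPhysics.KineticTheory.cellObs g ∈ F.localObs)) →
    (∃ z₂ : ℝ, 0 < z₂ ∧ ∀ σ : ℝ, 0 < σ → σ < 1 / 2 → ∀ z : ℝ, 0 < z → z < z₂ → ∀ θ : ℝ, 0 < θ →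
      ∀ F : Literature.MathematicalPhysics.KineticTheory.HardSphereFluctuationData 1,
        Literature.Analysis.FluidPDE.IsHardSphereGibbs 1 z 1
          (0 : Literature.MathematicalPhysics.KineticTheory.V3) F.μ →
        (∃ Φ : Literature.Analysis.FluidPDE.InfiniteHardSphereFlow (Fin 3) 1,
          Φ.IsEquilibriumFlow ∧ ∀ t : ℝ, F.flow t =ᵐ[F.μ] Φ.flow t) →
        (∫ ω, Literature.MathematicalPhysics.KineticTheory.cellCharge 0 ω ∂F.μ = σ ^ 3) →
        ∀ h : Literature.MathematicalPhysics.KineticTheory.V3 → ℝ, Continuous h →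
          (∃ (C : ℝ) (k : ℕ), ∀ v, |h v| ≤ C * (1 + ‖v‖) ^ k) →
          Literature.MathematicalPhysics.KineticTheory.cellObs (fun w => h (Real.sqrt θ • w)) ∈ F.localObs →
          (∫ v, h v * Literature.Analysis.FluidPDE.localMaxwellian 1 θ
              (0 : Literature.MathematicalPhysics.KineticTheory.V3) v = 0) →
          (∀ i : Fin 3, ∫ v, h v * v i * Literature.Analysis.FluidPDE.localMaxwellian 1 θ
              (0 : Literature.MathematicalPhysics.KineticTheory.V3) v = 0) →
          (∫ v, h v * ‖v‖ ^ 2 * Literature.Analysis.FluidPDE.localMaxwellian 1 θ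
              (0 : Literature.MathematicalPhysics.KineticTheory.V3) v = 0) →
          ∃ K : ℝ, ∀ Φ : (N : ℕ) → Literature.Analysis.FluidPDE.HardSphereFlow
              (Literature.Analysis.FluidPDE.Torus.geometry (Fin 3))
              (Literature.MathematicalPhysics.KineticTheory.hsDiameter σ N) (N + 1),
          ∀ χ : Literature.MathematicalPhysics.KineticTheory.T3 → ℝ, Continuous χ → ∀ s : ℝ,
            Tendsto (fun N : ℕ => ((N : ℝ) + 1) *
                cov[fun z => ∫ y, χ y.1 * h y.2 ∂(Literature.Analysis.FluidPDE.empiricalMeasure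
                      ((Φ N).flow (s * ((N : ℝ) + 1) ^ (-(1 / 3 : ℝ))) z)),
                    fun z => ∫ y, χ y.1 * h y.2 ∂(Literature.Analysis.FluidPDE.empiricalMeasure z);
                  Literature.MathematicalPhysics.KineticTheory.localGibbsLaw σ (fun _ => 1)
                    (fun _ => 0) (fun _ => θ) N (Φ N)])
              atTop (𝓝 ((∫ x, χ x * χ x) * K *
                ⟪F.koopman (Real.sqrt θ / σ * s)
                    (F.fluct (Literature.MathematicalPhysics.KineticTheory.cellObs
                      (fun w => h (Real.sqrt θ • w)))),
                  F.fluct (Literature.MathematicalPhysics.KineticTheory.cellObs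
                    (fun w => h (Real.sqrt θ • w)))⟫_ℝ))) →
    Summit.AtomisticToContinuum.HydrodynamicLimit.Theses.MourreKoopmanCharges.ChargesCompleteHS →
    Summit.AtomisticToContinuum.HydrodynamicLimit.Theses.MourreKoopmanCharges.OneBodyCompleteness := by
  intro h1 h2 h3
  refine oneBodyCompleteness_of_framework ?_ h2 h3
  intro z₀ hz₀
  obtain ⟨σ₁, hσ₁, H⟩ := h1 z₀ hz₀
  refine ⟨σ₁, hσ₁, fun σ hσ hσ1 => ?_⟩
  obtain ⟨F, z, hz, hzlt, hGibbs, hflow, hdens, hcont, hobs⟩ := H σ hσ hσ1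
  exact ⟨F, z, hz, hzlt, hGibbs, hflow, hdens, hcont, fun g hg hb =>
    ⟨hobs g hg hb, fun hm0 hm1 hm2 i =>
      inner_fluct_cellObs_chargeClass_eq_zero hz F hGibbs hg hb (hobs g hg hb) hm0 hm1 hm2 i⟩⟩

end Summit.AtomisticToContinuum.HydrodynamicLimit.Theorems.MourreKoopmanChargesOneBodyCompleteness

end
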